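import Mathlib.Data.Matrix.Basic
import Mathlib.Tactic.Linarith
import Mathlib.Tactic.FinCases
import HarnessLib

/-!
# Lane (V), line v2p5 — sparse `16 × 16` integer matrices for kernel-checked certificates

Cell `hodge-kum4`, crux stmt-Ventures-20141 (registered skeleton v2p5, stub `stub_cert`).  Generic plumbing, no
mathematics of the cell: a sparse integer matrix is a list of entries `(row, column, value)` (`SMat`); `eval` is its
dense `Matrix (Fin 16) (Fin 16) ℤ`; `mul`, `smul`, `norm` (one entry per occurring position), the super-bracket
`sbr A da B db = AB − (−1)^{|da||db|} BA` and the sparse equality test `beq` are COMPUTABLE list operations that the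
kernel evaluates quickly (the loop-superalgebra certificate has ≤ 16 non-zero entries per matrix), and the bridge
lemmas `eval_mul`, `eval_sbr`, `eval_eq_of_beq`, … transport the kernel's Boolean verdicts to matrix identities.
Nothing here asserts L1-Hilb(n) / L1 / HC_Kum4Type / HC.
-/

namespace Summit.Ventures.HodgeKum4.L1Hilb

namespace Cert

/-! ### Sparse integer matrices -/

/-- A sparse `16 × 16` integer matrix: a list of entries `(row, column, value)` (repetitions allowed, summed). -/
abbrev SMat : Type := List (ℕ × ℕ × ℤ)

namespace SMat

/-- The `(q, p)` entry: the sum of the values of the listed entries at `(q, p)`. -/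
def entry (A : SMat) (q p : ℕ) : ℤ :=
  A.foldr (fun e s ↦ if e.1 = q ∧ e.2.1 = p then e.2.2 + s else s) 0

/-- The dense matrix of a sparse one. -/
def eval (A : SMat) : Matrix (Fin 16) (Fin 16) ℤ :=
  Matrix.of fun Q P ↦ A.entry Q.val P.val

/-- All indices are `< 16`. -/
def wf (A : SMat) : Bool :=
  A.all fun e ↦ decide (e.1 < 16) && decide (e.2.1 < 16)

/-- Product (un-normalised). -/
def mul (A B : SMat) : SMat :=
  A.flatMap fun a ↦ B.filterMap fun b ↦ if a.2.1 = b.1 then some (a.1, b.2.1, a.2.2 * b.2.2) else none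

/-- Scalar multiple. -/
def smul (c : ℤ) (A : SMat) : SMat :=
  A.map fun a ↦ (a.1, a.2.1, c * a.2.2)

/-- The distinct positions `(row, column)` occurring in the list. -/
def positions (A : SMat) : List (ℕ × ℕ) :=
  A.foldr (fun e acc ↦ if (e.1, e.2.1) ∈ acc then acc else (e.1, e.2.1) :: acc) []

/-- Normal form: one entry per occurring position with non-zero total value. -/
def norm (A : SMat) : SMat :=
  (positions A).filterMap fun qp ↦ if A.entry qp.1 qp.2 = 0 then none else some (qp.1, qp.2, A.entry qp.1 qp.2)

/-- The sign `−(−1)^{|da||db|}` of the second term of a super-bracket. -/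
def sbrSign (da db : ℤ) : ℤ :=
  if da.natAbs % 2 = 1 ∧ db.natAbs % 2 = 1 then 1 else -1

/-- Super-bracket `[A, B} = AB − (−1)^{|da||db|} BA`, normalised. -/
def sbr (A : SMat) (da : ℤ) (B : SMat) (db : ℤ) : SMat :=
  norm (mul A B ++ smul (sbrSign da db) (mul B A))

/-- Equality of all entries, tested sparsely: the difference normalises to the empty list. -/
def beq (A B : SMat) : Bool :=
  (norm (A ++ smul (-1) B)).isEmpty

/-! #### Bridge lemmas -/

/-- The empty list has zero entries. -/
theorem entry_nil (q p : ℕ) : entry [] q p = 0 := rfl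

/-- Entries of a cons. -/
theorem entry_cons (e : ℕ × ℕ × ℤ) (A : SMat) (q p : ℕ) :
    entry (e :: A) q p = (if e.1 = q ∧ e.2.1 = p then e.2.2 else 0) + entry A q p := by
  simp only [entry, List.foldr_cons]
  split_ifs <;> simp

/-- Entries are additive under concatenation. -/
theorem entry_append (A B : SMat) (q p : ℕ) : entry (A ++ B) q p = entry A q p + entry B q p := by
  induction A with
  | nil => simp [entry_nil]
  | cons e A ih => rw [List.cons_append, entry_cons, entry_cons, ih, add_assoc]

/-- Entries of a scalar multiple. -/
theorem entry_smul (c : ℤ) (A : SMat) (q p : ℕ) : entry (smul c A) q p = c * entry A q p := by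
  induction A with
  | nil => simp [smul, entry_nil]
  | cons e A ih =>
    simp only [smul, List.map_cons] at ih ⊢
    rw [entry_cons, entry_cons, ih, mul_add]
    split_ifs <;> simp

/-- Entries of a concatenation of lists. -/
theorem entry_flatMap {α : Type} (l : List α) (f : α → SMat) (q p : ℕ) :
    entry (l.flatMap f) q p = (l.map fun a ↦ entry (f a) q p).sum := by
  induction l with
  | nil => simp [entry_nil]
  | cons a l ih => rw [List.flatMap_cons, entry_append, ih, List.map_cons, List.sum_cons]

/-- Entries of one row-times-matrix step of the product. -/
theorem entry_filterMap_single (B : SMat) (r q₀ : ℕ) (c : ℤ) (q p : ℕ) :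
    entry (B.filterMap fun b ↦ if r = b.1 then some (q₀, b.2.1, c * b.2.2) else none) q p =
      if q₀ = q then c * entry B r p else 0 := by
  induction B with
  | nil => simp [entry_nil]
  | cons b B ih =>
    by_cases hr : r = b.1
    · rw [List.filterMap_cons_some (b := (q₀, b.2.1, c * b.2.2)) (by simp [hr]), entry_cons, ih, entry_cons]
      by_cases hq : q₀ = q
      · subst hq
        by_cases hp : b.2.1 = p
        · simp [hp, hr, mul_add]
        · simp [hp]
      · simp [hq]
    · rw [List.filterMap_cons_none (by simp [hr]), ih, entry_cons]
      by_cases hq : q₀ = q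
      · have hne : ¬ (b.1 = r ∧ b.2.1 = p) := fun h ↦ hr h.1.symm
        simp [hne]
      · simp [hq]

/-- Entries of a product: `(AB)_{qp} = Σ_{a ∈ A, a.row = q} a.val · B_{a.col, p}`. -/
theorem entry_mul (A B : SMat) (q p : ℕ) :
    entry (mul A B) q p = (A.map fun a ↦ if a.1 = q then a.2.2 * entry B a.2.1 p else 0).sum := by
  rw [mul, entry_flatMap]
  congr 1
  refine List.map_congr_left fun a _ ↦ ?_
  have := entry_filterMap_single B a.2.1 a.1 a.2.2 q p
  simp only [eq_comm (a := a.2.1)] at this ⊢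
  convert this using 2

/-- With column indices `< 16`, the row-`q` entries of `A` against `B` regroup as `Σ_{r<16} A_{qr} B_{rp}`. -/
theorem entry_mul_eq_sum (A B : SMat) (hA : wf A = true) (q p : ℕ) :
    entry (mul A B) q p = ∑ r : Fin 16, entry A q r.val * entry B r.val p := by
  rw [entry_mul]
  induction A with
  | nil => simp [entry_nil]
  | cons a A ih =>
    have hA' : wf A = true := by simp [wf, List.all_cons] at hA ⊢; exact fun e he ↦ hA.2 e he
    have ha : a.2.1 < 16 := by simp [wf, List.all_cons] at hA; exact hA.1.2
    rw [List.map_cons, List.sum_cons, ih hA']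
    simp only [entry_cons, add_mul, Finset.sum_add_distrib]
    congr 1
    rw [Finset.sum_eq_single ⟨a.2.1, ha⟩]
    · by_cases hq : a.1 = q <;> simp [hq]
    · intro r _ hr
      have : ¬ (a.1 = q ∧ a.2.1 = r.val) := fun h ↦ hr (Fin.ext h.2.symm)
      simp [this]
    · simp

/-- Unfolding `eval`. -/
theorem eval_apply (A : SMat) (Q P : Fin 16) : eval A Q P = entry A Q.val P.val := rfl

/-- `eval` is additive under concatenation. -/
theorem eval_append (A B : SMat) : eval (A ++ B) = eval A + eval B := by
  ext Q P; simp [eval_apply, entry_append]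

/-- `eval` of a scalar multiple. -/
theorem eval_smul (c : ℤ) (A : SMat) : eval (smul c A) = c • eval A := by
  ext Q P; simp [eval_apply, entry_smul]

/-- `eval` is multiplicative (column indices of the left factor `< 16`). -/
theorem eval_mul (A B : SMat) (hA : wf A = true) : eval (mul A B) = eval A * eval B := by
  ext Q P
  rw [eval_apply, entry_mul_eq_sum A B hA, Matrix.mul_apply]
  rfl

/-- A non-zero entry comes from some listed entry at that position. -/
theorem exists_of_entry_ne_zero {A : SMat} {q p : ℕ} (h : entry A q p ≠ 0) : ∃ e ∈ A, e.1 = q ∧ e.2.1 = p := by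
  induction A with
  | nil => simp [entry_nil] at h
  | cons e A ih =>
    rw [entry_cons] at h
    by_cases he : e.1 = q ∧ e.2.1 = p
    · exact ⟨e, List.mem_cons_self, he⟩
    · rw [if_neg he, zero_add] at h
      obtain ⟨e', he', h'⟩ := ih h
      exact ⟨e', List.mem_cons_of_mem _ he', h'⟩


/-- Unfolding `positions` on a cons. -/
theorem positions_cons (e : ℕ × ℕ × ℤ) (A : SMat) :
    positions (e :: A) = if (e.1, e.2.1) ∈ positions A then positions A else (e.1, e.2.1) :: positions A := rfl

/-- Every listed entry has its position recorded. -/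
theorem mem_positions {A : SMat} {e : ℕ × ℕ × ℤ} (he : e ∈ A) : (e.1, e.2.1) ∈ positions A := by
  induction A with
  | nil => simp at he
  | cons f A ih =>
    rw [positions_cons]
    rcases List.mem_cons.mp he with rfl | he
    · split_ifs with h
      · exact h
      · exact List.mem_cons_self
    · split_ifs
      · exact ih he
      · exact List.mem_cons_of_mem _ (ih he)

/-- `positions` has no duplicates. -/
theorem nodup_positions (A : SMat) : (positions A).Nodup := by
  induction A with
  | nil => exact List.nodup_nil
  | cons f A ih =>
    rw [positions_cons]
    split_ifs with h
    · exact ih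
    · exact List.nodup_cons.mpr ⟨h, ih⟩

/-- Entries vanish off the recorded positions. -/
theorem entry_eq_zero_of_not_mem {A : SMat} {q p : ℕ} (h : (q, p) ∉ positions A) : entry A q p = 0 := by
  by_contra hne
  obtain ⟨e, he, h1, h2⟩ := exists_of_entry_ne_zero hne
  exact h (h1 ▸ h2 ▸ mem_positions he)

/-- Entries of the normal-form list built over a duplicate-free list of positions. -/
theorem entry_filterMap_positions (A : SMat) (l : List (ℕ × ℕ)) (hl : l.Nodup) (q p : ℕ) :
    entry (l.filterMap fun qp ↦ if A.entry qp.1 qp.2 = 0 then none else some (qp.1, qp.2, A.entry qp.1 qp.2)) q p =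
      if (q, p) ∈ l then entry A q p else 0 := by
  induction l with
  | nil => simp [entry_nil]
  | cons qp l ih =>
    rw [List.nodup_cons] at hl
    by_cases h0 : A.entry qp.1 qp.2 = 0
    · rw [List.filterMap_cons_none (by simp [h0]), ih hl.2]
      by_cases hm : (q, p) = qp
      · subst hm; simp [h0, hl.1]
      · simp [List.mem_cons, hm]
    · rw [List.filterMap_cons_some (b := (qp.1, qp.2, A.entry qp.1 qp.2)) (by simp [h0]), entry_cons, ih hl.2]
      by_cases hm : (q, p) = qp
      · subst hm; simp [hl.1]
      · have hne : ¬ (qp.1 = q ∧ qp.2 = p) := fun h ↦ hm (Prod.ext h.1.symm h.2.symm)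
        simp [List.mem_cons, hm, hne]

/-- Normalisation preserves all entries. -/
theorem entry_norm (A : SMat) (q p : ℕ) : entry (norm A) q p = entry A q p := by
  rw [norm, entry_filterMap_positions A _ (nodup_positions A)]
  split_ifs with h
  · rfl
  · exact (entry_eq_zero_of_not_mem h).symm

/-- Normalisation preserves `eval`. -/
theorem eval_norm (A : SMat) : eval (norm A) = eval A := by
  ext Q P; rw [eval_apply, eval_apply, entry_norm]

/-- The sparse equality test is sound for `eval`. -/
theorem eval_eq_of_beq {A B : SMat} (h : beq A B = true) : eval A = eval B := by
  ext Q P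
  rw [beq, List.isEmpty_iff] at h
  have h0 : entry (norm (A ++ smul (-1) B)) Q.val P.val = 0 := by rw [h, entry_nil]
  rw [entry_norm, entry_append, entry_smul] at h0
  rw [eval_apply, eval_apply]
  linarith

/-- The sign of the super-bracket. -/
theorem sbrSign_eq (da db : ℤ) : sbrSign da db = -((-1 : ℤ) ^ (da.natAbs * db.natAbs)) := by
  unfold sbrSign
  split_ifs with h
  · have hodd : Odd (da.natAbs * db.natAbs) := Nat.odd_mul.mpr ⟨Nat.odd_iff.mpr h.1, Nat.odd_iff.mpr h.2⟩
    rw [hodd.neg_one_pow]; norm_num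
  · have hev : Even (da.natAbs * db.natAbs) := by
      rw [Nat.even_mul]
      rcases not_and_or.mp h with h | h
      · exact Or.inl (Nat.even_iff.mpr (by omega))
      · exact Or.inr (Nat.even_iff.mpr (by omega))
    rw [hev.neg_one_pow]

/-- `eval` of the sparse super-bracket `[A, B} = AB − (−1)^{|da||db|} BA` (indices of `A`, `B` `< 16`). -/
theorem eval_sbr (A : SMat) (da : ℤ) (B : SMat) (db : ℤ) (hA : wf A = true) (hB : wf B = true) :
    eval (sbr A da B db) = eval A * eval B - ((-1 : ℤ) ^ (da.natAbs * db.natAbs)) • (eval B * eval A) := by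
  rw [sbr, eval_norm, eval_append, eval_smul, eval_mul A B hA, eval_mul B A hB, sbrSign_eq, neg_smul, sub_eq_add_neg]

end SMat

end Cert

end Summit.Ventures.HodgeKum4.L1Hilb
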